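import Literature.Probability.LatticeModels.GaussianFieldKernelLetters
import Mathlib.Probability.Independence.Basic
import HarnessLib

/-!
# Gaussian fields: the reflection coupling `(Z + U, Z + U′)` and the positivity `E[g(Y) g(X)] ≥ 0`

Theorem-only file (no definitions, no named facts), over the tree's centred Gaussian fields `gaussianFieldOfKernel K` on
`ι → ℝ` (`Literature.MathematicalPhysics.QuantumFieldTheory`, `CurvatureGaussianField.lean`).  It supplies the probabilistic
core of the REFLECTION POSITIVITY OF GAUSSIAN LATTICE FIELDS on ALL bounded local observables (Glimm–Jaffe 1987 Thm. 6.2.2 ∕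
§6.3 for the free field; Fröhlich–Israel–Lieb–Simon 1978 §3 «Gaussian domination»), by a COUPLING argument that avoids the
density of the exponential algebra: if `X, Y` are centred Gaussian vectors indexed by a finite set `W` with the same covariance
`A` and a symmetric positive-semidefinite cross covariance `R = Cov(Y, X)` (so that `A − R ⪰ 0` as well), then
`(X, Y)` has the law of `(Z + U, Z + U′)` with `Z ~ N(0, R)`, `U, U′ ~ N(0, A − R)` INDEPENDENT, whence for every bounded
measurable `g`, `E[g(Y) g(X)] = E_Z[(E_U g(Z + U))²] ≥ 0`.

Contents (the generic letters — sum form of positivity, re-indexing push-forward, `IsGaussian`, covariance kernels — are in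
`GaussianFieldKernelLetters.lean`).  The coupling on a finite index type `W`: the joint kernel
`Σ = [[A, R], [R, A]]` on `W ⊕ W`, ★ `gaussianFieldOfKernel Σ = (N(0,R) ⊗ N(0,A−R) ⊗ N(0,A−R)).map (z,u,u′) ↦ (z+u, z+u′)`
(`gaussianFieldOfKernel_joint_eq_map_coupling`), and ★★ `0 ≤ ∫ g(x ∘ inr) g(x ∘ inl) dN(0,Σ)` (`integral_mul_nonneg_of_coupling`).
The lattice statement (reflections, positive half, bounded local observables, `IsReflectionPositive`) is in
`GaussianFieldReflectionPositivity.lean`.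

## References

* J. Glimm, A. Jaffe, *Quantum Physics* (2nd ed. 1987), §6.2 Thm. 6.2.2, §6.3. [GlimmJaffe1987]
* J. Fröhlich, R. Israel, E. H. Lieb, B. Simon, Comm. Math. Phys. 62 (1978) 1–34, §3. [FILS1978]
* O. Kallenberg, *Foundations of Modern Probability* (2002), Lemma 13.1 (Gaussian laws determined by covariances). [Kallenberg2002]

Mathlib: `IsGaussian`, `HasGaussianLaw`, `IsGaussianProcess` (`of_isGaussianProcess`, `hasGaussianLaw`), `indepFun_prod`,
`IndepFun.covariance_eq_zero`, `covariance_map`, `covariance_add_left∕right`, `integral_prod`, `integral_prod_mul`,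
`integral_fun_fst∕snd`, `Matrix.PosSemidef.dotProduct_mulVec_nonneg ∕ of_dotProduct_mulVec_nonneg`.
-/

noncomputable section

open MeasureTheory ProbabilityTheory Finset
open scoped BigOperators Matrix

namespace Literature.Probability.LatticeModels

open Literature.MathematicalPhysics.QuantumFieldTheory (IsPosSemidefKernel covGram covGram_apply gaussianFieldOfKernel
  isProbabilityMeasure_gaussianFieldOfKernel isGaussianProcess_eval_gaussianFieldOfKernel integral_eval_gaussianFieldOfKernel
  covariance_eval_gaussianFieldOfKernel eq_gaussianFieldOfKernel_of_isGaussianProcess)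

/-! ## The coupling `(Z + U, Z + U′)` on a finite index type

Throughout, `A R : W → W → ℝ` with `R ⪰ 0` and `D := A − R ⪰ 0`; `ρ = N(0,R)`, `ν = N(0,D)` are the Gaussian fields of these kernels on
`W → ℝ`, `Ξ = ρ ⊗ (ν ⊗ ν)` the coupling space with coordinates `(z, (u, u′))`, `Ψ(z,(u,u′)) = (z + u, z + u′) ∈ ℝ^{W ⊕ W}` the coupling
map, and `Σ = [[A, R], [R, A]]` the joint kernel on `W ⊕ W` (written with `Sum.elim`; no definitions are introduced). -/

section Coupling

variable {W : Type*} [Fintype W] [DecidableEq W]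

omit [Fintype W] [DecidableEq W] in
/-- The coupling map `(z,(u,u′)) ↦ (z+u, z+u′)` is measurable. [cite: GlimmJaffe1987, §6.2 Thm. 6.2.2 (the coupling map)] -/
theorem measurable_couplingMap :
    Measurable fun (p : (W → ℝ) × ((W → ℝ) × (W → ℝ))) (j : W ⊕ W) => Sum.elim (p.1 + p.2.1) (p.1 + p.2.2) j := by
  refine measurable_pi_lambda _ fun j => ?_
  rcases j with a | a
  · simp only [Sum.elim_inl, Pi.add_apply]
    exact ((measurable_pi_apply a).comp measurable_fst).add ((measurable_pi_apply a).comp (measurable_fst.comp measurable_snd))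
  · simp only [Sum.elim_inr, Pi.add_apply]
    exact ((measurable_pi_apply a).comp measurable_fst).add ((measurable_pi_apply a).comp (measurable_snd.comp measurable_snd))

omit [DecidableEq W] in
/-- The coupling map is (the coercion of) a continuous linear map. [cite: GlimmJaffe1987, §6.2 Thm. 6.2.2 (the coupling map)] -/
theorem exists_continuousLinearMap_couplingMap :
    ∃ L : ((W → ℝ) × ((W → ℝ) × (W → ℝ))) →L[ℝ] (W ⊕ W → ℝ),
      ⇑L = fun (p : (W → ℝ) × ((W → ℝ) × (W → ℝ))) (j : W ⊕ W) => Sum.elim (p.1 + p.2.1) (p.1 + p.2.2) j := by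
  refine ⟨LinearMap.toContinuousLinearMap
    { toFun := fun p j => Sum.elim (p.1 + p.2.1) (p.1 + p.2.2) j
      map_add' := fun p q => ?_
      map_smul' := fun c p => ?_ }, rfl⟩
  · funext j
    rcases j with a | a <;> simp only [Prod.fst_add, Prod.snd_add, Sum.elim_inl, Sum.elim_inr, Pi.add_apply] <;> ring
  · funext j
    rcases j with a | a <;> simp only [Prod.smul_fst, Prod.smul_snd, Sum.elim_inl, Sum.elim_inr, Pi.add_apply, Pi.smul_apply, smul_eq_mul,
      RingHom.id_apply] <;> ring

/-- On a product of probability spaces, `∫ f(p.1) = ∫ f`. [folklore] -/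
private theorem integral_comp_fst_prod {α β : Type*} [MeasurableSpace α] [MeasurableSpace β] (μ : Measure α) (κ : Measure β) [SFinite μ] [IsProbabilityMeasure κ]
    (f : α → ℝ) : ∫ p, f p.1 ∂(μ.prod κ) = ∫ a, f a ∂μ := by
  rw [integral_fun_fst]; simp

/-- On a product of probability spaces, `∫ f(p.2) = ∫ f`. [folklore] -/
private theorem integral_comp_snd_prod {α β : Type*} [MeasurableSpace α] [MeasurableSpace β] (μ : Measure α) (κ : Measure β) [IsProbabilityMeasure μ] [SFinite κ]
    (f : β → ℝ) : ∫ p, f p.2 ∂(μ.prod κ) = ∫ b, f b ∂κ := by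
  rw [integral_fun_snd]; simp

/-- Covariances of first-factor observables on a product of probability spaces. [folklore] -/
private theorem covariance_comp_fst_prod {α β : Type*} [MeasurableSpace α] [MeasurableSpace β] (μ : Measure α) (κ : Measure β) [SFinite μ] [SFinite κ]
    [IsProbabilityMeasure κ] {f g : α → ℝ} (hf : Measurable f) (hg : Measurable g) :
    cov[fun p => f p.1, fun p => g p.1; μ.prod κ] = cov[f, g; μ] := by
  have h := covariance_map (μ := μ.prod κ) (Z := Prod.fst) (X := f) (Y := g) hf.aestronglyMeasurable hg.aestronglyMeasurable
    measurable_fst.aemeasurable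
  rw [Measure.map_fst_prod, measure_univ, one_smul] at h
  exact h.symm

/-- Covariances of second-factor observables on a product of probability spaces. [folklore] -/
private theorem covariance_comp_snd_prod {α β : Type*} [MeasurableSpace α] [MeasurableSpace β] (μ : Measure α) (κ : Measure β) [SFinite μ] [SFinite κ]
    [IsProbabilityMeasure μ] {f g : β → ℝ} (hf : Measurable f) (hg : Measurable g) :
    cov[fun p => f p.2, fun p => g p.2; μ.prod κ] = cov[f, g; κ] := by
  have h := covariance_map (μ := μ.prod κ) (Z := Prod.snd) (X := f) (Y := g) hf.aestronglyMeasurable hg.aestronglyMeasurable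
    measurable_snd.aemeasurable
  rw [Measure.map_snd_prod, measure_univ, one_smul] at h
  exact h.symm

variable {A R : W → W → ℝ}

/-- ★ **THE COVARIANCES OF THE COUPLING**: under `Ξ = N(0,R) ⊗ (N(0,A−R) ⊗ N(0,A−R))` the process `j ↦ Ψ(·)_j` has covariance kernel
`Σ = [[A, R], [R, A]]`: `Cov(Z_a+U_a, Z_b+U_b) = R + (A−R) = A`, `Cov(Z_a+U_a, Z_b+U′_b) = R`, by bilinearity and the independence
(`indepFun_prod`) of the three factors. [cite: GlimmJaffe1987, §6.2 Thm. 6.2.2] -/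
theorem covariance_couplingMap (hR : IsPosSemidefKernel R) (hD : IsPosSemidefKernel fun a b => A a b - R a b) (j j' : W ⊕ W) :
    cov[fun p => Sum.elim (p.1 + p.2.1) (p.1 + p.2.2) j, fun p => Sum.elim (p.1 + p.2.1) (p.1 + p.2.2) j';
        (gaussianFieldOfKernel R).prod ((gaussianFieldOfKernel fun a b => A a b - R a b).prod (gaussianFieldOfKernel fun a b => A a b - R a b))]
      = Sum.elim (fun a => Sum.elim (A a) (R a) j') (fun a => Sum.elim (R a) (A a) j') j := by
  set ρ := gaussianFieldOfKernel R with hρ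
  set ν := gaussianFieldOfKernel (fun a b => A a b - R a b) with hν
  haveI := isProbabilityMeasure_gaussianFieldOfKernel hR
  haveI := isProbabilityMeasure_gaussianFieldOfKernel hD
  -- square integrability of the coordinates
  have hρ2 : ∀ a, MemLp (fun z : W → ℝ => z a) 2 ρ := fun a => ((isGaussianProcess_eval_gaussianFieldOfKernel hR).hasGaussianLaw_eval a).memLp_two
  have hν2 : ∀ a, MemLp (fun u : W → ℝ => u a) 2 ν := fun a => ((isGaussianProcess_eval_gaussianFieldOfKernel hD).hasGaussianLaw_eval a).memLp_two
  have hmpZ : MeasurePreserving (Prod.fst : (W → ℝ) × ((W → ℝ) × (W → ℝ)) → (W → ℝ)) (ρ.prod (ν.prod ν)) ρ := measurePreserving_fst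
  have hmpU : MeasurePreserving (fun p : (W → ℝ) × ((W → ℝ) × (W → ℝ)) => p.2.1) (ρ.prod (ν.prod ν)) ν :=
    measurePreserving_fst.comp measurePreserving_snd
  have hmpU' : MeasurePreserving (fun p : (W → ℝ) × ((W → ℝ) × (W → ℝ)) => p.2.2) (ρ.prod (ν.prod ν)) ν :=
    measurePreserving_snd.comp measurePreserving_snd
  have hZ2 : ∀ a, MemLp (fun p : (W → ℝ) × ((W → ℝ) × (W → ℝ)) => p.1 a) 2 (ρ.prod (ν.prod ν)) := fun a => (hρ2 a).comp_measurePreserving hmpZ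
  have hU2 : ∀ a, MemLp (fun p : (W → ℝ) × ((W → ℝ) × (W → ℝ)) => p.2.1 a) 2 (ρ.prod (ν.prod ν)) := fun a => (hν2 a).comp_measurePreserving hmpU
  have hU'2 : ∀ a, MemLp (fun p : (W → ℝ) × ((W → ℝ) × (W → ℝ)) => p.2.2 a) 2 (ρ.prod (ν.prod ν)) := fun a => (hν2 a).comp_measurePreserving hmpU'
  -- the elementary covariances
  have hZZ : ∀ a b, cov[fun p : (W → ℝ) × ((W → ℝ) × (W → ℝ)) => p.1 a, fun p => p.1 b; ρ.prod (ν.prod ν)] = R a b := fun a b => by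
    rw [covariance_comp_fst_prod ρ (ν.prod ν) (measurable_pi_apply a) (measurable_pi_apply b)]
    exact covariance_eval_gaussianFieldOfKernel hR a b
  have hUU : ∀ a b, cov[fun p : (W → ℝ) × ((W → ℝ) × (W → ℝ)) => p.2.1 a, fun p => p.2.1 b; ρ.prod (ν.prod ν)] = A a b - R a b := fun a b => by
    rw [covariance_comp_snd_prod ρ (ν.prod ν) (f := fun q : (W → ℝ) × (W → ℝ) => q.1 a) (g := fun q => q.1 b)
      ((measurable_pi_apply a).comp measurable_fst) ((measurable_pi_apply b).comp measurable_fst),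
      covariance_comp_fst_prod ν ν (measurable_pi_apply a) (measurable_pi_apply b)]
    exact covariance_eval_gaussianFieldOfKernel hD a b
  have hU'U' : ∀ a b, cov[fun p : (W → ℝ) × ((W → ℝ) × (W → ℝ)) => p.2.2 a, fun p => p.2.2 b; ρ.prod (ν.prod ν)] = A a b - R a b := fun a b => by
    rw [covariance_comp_snd_prod ρ (ν.prod ν) (f := fun q : (W → ℝ) × (W → ℝ) => q.2 a) (g := fun q => q.2 b)
      ((measurable_pi_apply a).comp measurable_snd) ((measurable_pi_apply b).comp measurable_snd),
      covariance_comp_snd_prod ν ν (measurable_pi_apply a) (measurable_pi_apply b)]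
    exact covariance_eval_gaussianFieldOfKernel hD a b
  have hZU : ∀ a b, cov[fun p : (W → ℝ) × ((W → ℝ) × (W → ℝ)) => p.1 a, fun p => p.2.1 b; ρ.prod (ν.prod ν)] = 0 := fun a b =>
    (indepFun_prod (μ := ρ) (ν := ν.prod ν) (X := fun z : W → ℝ => z a) (Y := fun q : (W → ℝ) × (W → ℝ) => q.1 b) (measurable_pi_apply a)
      ((measurable_pi_apply b).comp measurable_fst)).covariance_eq_zero (hZ2 a) (hU2 b)
  have hZU' : ∀ a b, cov[fun p : (W → ℝ) × ((W → ℝ) × (W → ℝ)) => p.1 a, fun p => p.2.2 b; ρ.prod (ν.prod ν)] = 0 := fun a b =>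
    (indepFun_prod (μ := ρ) (ν := ν.prod ν) (X := fun z : W → ℝ => z a) (Y := fun q : (W → ℝ) × (W → ℝ) => q.2 b) (measurable_pi_apply a)
      ((measurable_pi_apply b).comp measurable_snd)).covariance_eq_zero (hZ2 a) (hU'2 b)
  have hUU' : ∀ a b, cov[fun p : (W → ℝ) × ((W → ℝ) × (W → ℝ)) => p.2.1 a, fun p => p.2.2 b; ρ.prod (ν.prod ν)] = 0 := fun a b => by
    rw [covariance_comp_snd_prod ρ (ν.prod ν) (f := fun q : (W → ℝ) × (W → ℝ) => q.1 a) (g := fun q => q.2 b)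
      ((measurable_pi_apply a).comp measurable_fst) ((measurable_pi_apply b).comp measurable_snd)]
    exact (indepFun_prod (μ := ν) (ν := ν) (X := fun u : W → ℝ => u a) (Y := fun u : W → ℝ => u b) (measurable_pi_apply a)
      (measurable_pi_apply b)).covariance_eq_zero ((hν2 a).comp_measurePreserving measurePreserving_fst) ((hν2 b).comp_measurePreserving measurePreserving_snd)
  -- symmetric versions
  have hUZ : ∀ a b, cov[fun p : (W → ℝ) × ((W → ℝ) × (W → ℝ)) => p.2.1 a, fun p => p.1 b; ρ.prod (ν.prod ν)] = 0 := fun a b => by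
    rw [covariance_comm]; exact hZU b a
  have hU'Z : ∀ a b, cov[fun p : (W → ℝ) × ((W → ℝ) × (W → ℝ)) => p.2.2 a, fun p => p.1 b; ρ.prod (ν.prod ν)] = 0 := fun a b => by
    rw [covariance_comm]; exact hZU' b a
  have hU'U : ∀ a b, cov[fun p : (W → ℝ) × ((W → ℝ) × (W → ℝ)) => p.2.2 a, fun p => p.2.1 b; ρ.prod (ν.prod ν)] = 0 := fun a b => by
    rw [covariance_comm]; exact hUU' b a
  have hRsymm : ∀ a b, R a b = R b a := isPosSemidefKernel_symm hR
  -- the four blocks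
  rcases j with a | a <;> rcases j' with b | b <;>
    simp only [Sum.elim_inl, Sum.elim_inr]
  · -- (inl, inl): Cov(Z_a + U_a, Z_b + U_b) = R + (A − R)
    have e1 : (fun p : (W → ℝ) × ((W → ℝ) × (W → ℝ)) => (p.1 + p.2.1) a) = (fun p => p.1 a) + fun p => p.2.1 a := by funext p; rfl
    have e2 : (fun p : (W → ℝ) × ((W → ℝ) × (W → ℝ)) => (p.1 + p.2.1) b) = (fun p => p.1 b) + fun p => p.2.1 b := by funext p; rfl
    rw [e1, e2, covariance_add_left (hZ2 a) (hU2 a) ((hZ2 b).add (hU2 b)), covariance_add_right (hZ2 a) (hZ2 b) (hU2 b),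
      covariance_add_right (hU2 a) (hZ2 b) (hU2 b), hZZ, hZU, hUZ, hUU]
    ring
  · -- (inl, inr): Cov(Z_a + U_a, Z_b + U′_b) = R
    have e1 : (fun p : (W → ℝ) × ((W → ℝ) × (W → ℝ)) => (p.1 + p.2.1) a) = (fun p => p.1 a) + fun p => p.2.1 a := by funext p; rfl
    have e2 : (fun p : (W → ℝ) × ((W → ℝ) × (W → ℝ)) => (p.1 + p.2.2) b) = (fun p => p.1 b) + fun p => p.2.2 b := by funext p; rfl
    rw [e1, e2, covariance_add_left (hZ2 a) (hU2 a) ((hZ2 b).add (hU'2 b)), covariance_add_right (hZ2 a) (hZ2 b) (hU'2 b),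
      covariance_add_right (hU2 a) (hZ2 b) (hU'2 b), hZZ, hZU', hUZ, hUU']
    ring
  · -- (inr, inl): Cov(Z_a + U′_a, Z_b + U_b) = R
    have e1 : (fun p : (W → ℝ) × ((W → ℝ) × (W → ℝ)) => (p.1 + p.2.2) a) = (fun p => p.1 a) + fun p => p.2.2 a := by funext p; rfl
    have e2 : (fun p : (W → ℝ) × ((W → ℝ) × (W → ℝ)) => (p.1 + p.2.1) b) = (fun p => p.1 b) + fun p => p.2.1 b := by funext p; rfl
    rw [e1, e2, covariance_add_left (hZ2 a) (hU'2 a) ((hZ2 b).add (hU2 b)), covariance_add_right (hZ2 a) (hZ2 b) (hU2 b),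
      covariance_add_right (hU'2 a) (hZ2 b) (hU2 b), hZZ, hZU, hU'Z, hU'U]
    ring
  · -- (inr, inr): Cov(Z_a + U′_a, Z_b + U′_b) = R + (A − R)
    have e1 : (fun p : (W → ℝ) × ((W → ℝ) × (W → ℝ)) => (p.1 + p.2.2) a) = (fun p => p.1 a) + fun p => p.2.2 a := by funext p; rfl
    have e2 : (fun p : (W → ℝ) × ((W → ℝ) × (W → ℝ)) => (p.1 + p.2.2) b) = (fun p => p.1 b) + fun p => p.2.2 b := by funext p; rfl
    rw [e1, e2, covariance_add_left (hZ2 a) (hU'2 a) ((hZ2 b).add (hU'2 b)), covariance_add_right (hZ2 a) (hZ2 b) (hU'2 b),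
      covariance_add_right (hU'2 a) (hZ2 b) (hU'2 b), hZZ, hZU', hU'Z, hU'U']
    ring

/-- ★ **THE LAW OF THE COUPLING IS THE JOINT GAUSSIAN LAW**: `N(0, Σ) = (N(0,R) ⊗ N(0,A−R) ⊗ N(0,A−R)).map ((z,u,u′) ↦ (z+u, z+u′))`, `Σ = [[A,R],[R,A]]` on
`W ⊕ W` (the push-forward is a centred Gaussian law — a linear image of a product of Gaussian measures — with covariance `Σ`; Gaussian laws are
determined by their covariances; in particular `Σ ⪰ 0`, being a covariance kernel). [cite: GlimmJaffe1987, §6.2 Thm. 6.2.2] [cite: Kallenberg2002, Lemma 13.1] -/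
theorem gaussianFieldOfKernel_joint_eq_map_coupling (hR : IsPosSemidefKernel R) (hD : IsPosSemidefKernel fun a b => A a b - R a b) :
    gaussianFieldOfKernel (fun j j' : W ⊕ W => Sum.elim (fun a => Sum.elim (A a) (R a) j') (fun a => Sum.elim (R a) (A a) j') j)
      = ((gaussianFieldOfKernel R).prod ((gaussianFieldOfKernel fun a b => A a b - R a b).prod (gaussianFieldOfKernel fun a b => A a b - R a b))).map
          (fun (p : (W → ℝ) × ((W → ℝ) × (W → ℝ))) (j : W ⊕ W) => Sum.elim (p.1 + p.2.1) (p.1 + p.2.2) j) := by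
  set ρ := gaussianFieldOfKernel R with hρ
  set ν := gaussianFieldOfKernel (fun a b => A a b - R a b) with hν
  set Ψ : (W → ℝ) × ((W → ℝ) × (W → ℝ)) → (W ⊕ W → ℝ) := fun p j => Sum.elim (p.1 + p.2.1) (p.1 + p.2.2) j with hΨ
  haveI := isProbabilityMeasure_gaussianFieldOfKernel hR
  haveI := isProbabilityMeasure_gaussianFieldOfKernel hD
  haveI : IsGaussian ρ := isGaussian_gaussianFieldOfKernel hR
  haveI : IsGaussian ν := isGaussian_gaussianFieldOfKernel hD
  haveI : IsGaussian (ν.prod ν) := inferInstance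
  haveI : IsGaussian (ρ.prod (ν.prod ν)) := inferInstance
  have hΨm : Measurable Ψ := measurable_couplingMap
  haveI : IsProbabilityMeasure ((ρ.prod (ν.prod ν)).map Ψ) := Measure.isProbabilityMeasure_map hΨm.aemeasurable
  obtain ⟨L, hL⟩ := exists_continuousLinearMap_couplingMap (W := W)
  haveI : IsGaussian ((ρ.prod (ν.prod ν)).map Ψ) := by rw [hΨ, ← hL]; infer_instance
  -- covariances of the coordinates under the push-forward
  have hcov : ∀ j j', cov[fun x : W ⊕ W → ℝ => x j, fun x => x j'; (ρ.prod (ν.prod ν)).map Ψ]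
      = Sum.elim (fun a => Sum.elim (A a) (R a) j') (fun a => Sum.elim (R a) (A a) j') j := fun j j' => by
    rw [covariance_map (measurable_pi_apply j).aestronglyMeasurable (measurable_pi_apply j').aestronglyMeasurable hΨm.aemeasurable]
    exact covariance_couplingMap hR hD j j'
  -- the joint kernel is positive semidefinite: it is a covariance kernel
  have hGP : IsGaussianProcess (fun (j : W ⊕ W) (x : W ⊕ W → ℝ) => x j) ((ρ.prod (ν.prod ν)).map Ψ) :=
    isGaussianProcess_apply_of_hasGaussianLaw (IsGaussian.hasGaussianLaw_id (μ := (ρ.prod (ν.prod ν)).map Ψ))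
  have hmem : ∀ j, MemLp (fun x : W ⊕ W → ℝ => x j) 2 ((ρ.prod (ν.prod ν)).map Ψ) := fun j => (hGP.hasGaussianLaw_eval j).memLp_two
  have hSig : IsPosSemidefKernel fun j j' : W ⊕ W => Sum.elim (fun a => Sum.elim (A a) (R a) j') (fun a => Sum.elim (R a) (A a) j') j := by
    have h := isPosSemidefKernel_covariance (P := (ρ.prod (ν.prod ν)).map Ψ) hmem
    have e : (fun j j' => cov[fun x : W ⊕ W → ℝ => x j, fun x => x j'; (ρ.prod (ν.prod ν)).map Ψ])
        = fun j j' : W ⊕ W => Sum.elim (fun a => Sum.elim (A a) (R a) j') (fun a => Sum.elim (R a) (A a) j') j :=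
      funext fun j => funext fun j' => hcov j j'
    rwa [e] at h
  -- square integrability of the coordinates of the three factors
  have hρ1 : ∀ a, Integrable (fun z : W → ℝ => z a) ρ := fun a => ((isGaussianProcess_eval_gaussianFieldOfKernel hR).hasGaussianLaw_eval a).integrable
  have hν1 : ∀ a, Integrable (fun u : W → ℝ => u a) ν := fun a => ((isGaussianProcess_eval_gaussianFieldOfKernel hD).hasGaussianLaw_eval a).integrable
  have hZ1 : ∀ a, Integrable (fun p : (W → ℝ) × ((W → ℝ) × (W → ℝ)) => p.1 a) (ρ.prod (ν.prod ν)) := fun a =>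
    (measurePreserving_fst (μ := ρ) (ν := ν.prod ν)).integrable_comp_of_integrable (hρ1 a)
  have hU1 : ∀ a, Integrable (fun p : (W → ℝ) × ((W → ℝ) × (W → ℝ)) => p.2.1 a) (ρ.prod (ν.prod ν)) := fun a =>
    ((measurePreserving_fst (μ := ν) (ν := ν)).comp (measurePreserving_snd (μ := ρ) (ν := ν.prod ν))).integrable_comp_of_integrable (hν1 a)
  have hU'1 : ∀ a, Integrable (fun p : (W → ℝ) × ((W → ℝ) × (W → ℝ)) => p.2.2 a) (ρ.prod (ν.prod ν)) := fun a =>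
    ((measurePreserving_snd (μ := ν) (ν := ν)).comp (measurePreserving_snd (μ := ρ) (ν := ν.prod ν))).integrable_comp_of_integrable (hν1 a)
  symm
  refine eq_gaussianFieldOfKernel_of_isGaussianProcess hSig hGP (fun j => ?_) hcov
  rw [integral_map hΨm.aemeasurable (measurable_pi_apply j).aestronglyMeasurable]
  rcases j with a | a
  · change ∫ p, p.1 a + p.2.1 a ∂(ρ.prod (ν.prod ν)) = 0
    rw [integral_add (hZ1 a) (hU1 a), integral_comp_fst_prod ρ (ν.prod ν) (fun z : W → ℝ => z a),
      integral_comp_snd_prod ρ (ν.prod ν) (fun q : (W → ℝ) × (W → ℝ) => q.1 a), integral_comp_fst_prod ν ν (fun u : W → ℝ => u a),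
      integral_eval_gaussianFieldOfKernel hR a, integral_eval_gaussianFieldOfKernel hD a, add_zero]
  · change ∫ p, p.1 a + p.2.2 a ∂(ρ.prod (ν.prod ν)) = 0
    rw [integral_add (hZ1 a) (hU'1 a), integral_comp_fst_prod ρ (ν.prod ν) (fun z : W → ℝ => z a),
      integral_comp_snd_prod ρ (ν.prod ν) (fun q : (W → ℝ) × (W → ℝ) => q.2 a), integral_comp_snd_prod ν ν (fun u : W → ℝ => u a),
      integral_eval_gaussianFieldOfKernel hR a, integral_eval_gaussianFieldOfKernel hD a, add_zero]

/-- ★★ **THE COUPLING POSITIVITY** `E[g(Y) g(X)] = E_Z[(E_U g(Z+U))²] ≥ 0`: for every bounded measurable `g : ℝ^W → ℝ`,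
`0 ≤ ∫ g(x|_{inr}) g(x|_{inl}) dN(0, Σ)`, `Σ = [[A,R],[R,A]]` with `R ⪰ 0`, `A − R ⪰ 0` — reflection positivity of a Gaussian pair on ALL bounded
observables, with no density argument. [cite: GlimmJaffe1987, §6.2 Thm. 6.2.2] [cite: FILS1978, §3] -/
theorem integral_mul_nonneg_of_coupling (hR : IsPosSemidefKernel R) (hD : IsPosSemidefKernel fun a b => A a b - R a b)
    {g : (W → ℝ) → ℝ} (hg : Measurable g) {C : ℝ} (hgb : ∀ x, |g x| ≤ C) :
    0 ≤ ∫ x, g (fun a => x (Sum.inr a)) * g (fun a => x (Sum.inl a))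
      ∂gaussianFieldOfKernel (fun j j' : W ⊕ W => Sum.elim (fun a => Sum.elim (A a) (R a) j') (fun a => Sum.elim (R a) (A a) j') j) := by
  set ρ := gaussianFieldOfKernel R with hρ
  set ν := gaussianFieldOfKernel (fun a b => A a b - R a b) with hν
  haveI := isProbabilityMeasure_gaussianFieldOfKernel hR
  haveI := isProbabilityMeasure_gaussianFieldOfKernel hD
  have hΨm : Measurable fun (p : (W → ℝ) × ((W → ℝ) × (W → ℝ))) (j : W ⊕ W) => Sum.elim (p.1 + p.2.1) (p.1 + p.2.2) j := measurable_couplingMap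
  have hFm : Measurable fun x : W ⊕ W → ℝ => g (fun a => x (Sum.inr a)) * g (fun a => x (Sum.inl a)) :=
    (hg.comp (measurable_pi_lambda _ fun a => measurable_pi_apply (Sum.inr a))).mul (hg.comp (measurable_pi_lambda _ fun a => measurable_pi_apply (Sum.inl a)))
  rw [gaussianFieldOfKernel_joint_eq_map_coupling hR hD, integral_map hΨm.aemeasurable hFm.aestronglyMeasurable]
  change 0 ≤ ∫ p, g (p.1 + p.2.2) * g (p.1 + p.2.1) ∂(ρ.prod (ν.prod ν))
  have hC0 : 0 ≤ C := (abs_nonneg _).trans (hgb 0)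
  -- integrability of the bounded integrand
  have hGm : Measurable fun p : (W → ℝ) × ((W → ℝ) × (W → ℝ)) => g (p.1 + p.2.2) * g (p.1 + p.2.1) :=
    (hg.comp (measurable_fst.add (measurable_snd.comp measurable_snd))).mul (hg.comp (measurable_fst.add (measurable_fst.comp measurable_snd)))
  have hint : Integrable (fun p : (W → ℝ) × ((W → ℝ) × (W → ℝ)) => g (p.1 + p.2.2) * g (p.1 + p.2.1)) (ρ.prod (ν.prod ν)) := by
    refine Integrable.of_bound hGm.aestronglyMeasurable (C * C) (ae_of_all _ fun p => ?_)
    rw [Real.norm_eq_abs, abs_mul]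
    exact mul_le_mul (hgb _) (hgb _) (abs_nonneg _) hC0
  rw [integral_prod _ hint]
  refine integral_nonneg fun z => ?_
  change 0 ≤ ∫ q, g (z + q.2) * g (z + q.1) ∂(ν.prod ν)
  have hswap : (fun q : (W → ℝ) × (W → ℝ) => g (z + q.2) * g (z + q.1)) = fun q => g (z + q.1) * g (z + q.2) := funext fun q => mul_comm _ _
  rw [hswap, integral_prod_mul (μ := ν) (ν := ν) (f := fun u : W → ℝ => g (z + u)) (g := fun u : W → ℝ => g (z + u))]
  exact mul_self_nonneg _

end Coupling

end Literature.Probability.LatticeModels
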